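import Summits.AtomisticToContinuum.HydrodynamicLimit.Theses.TwoClocks
import Summits.AtomisticToContinuum.HydrodynamicLimit.Theses.OneFlightGossipEngine
import Summits.AtomisticToContinuum.HydrodynamicLimit.Theorems.ImplosionDichotomyHydroLimitInBandOfHeart
import Summits.AtomisticToContinuum.HydrodynamicLimit.Theorems.ImplosionDichotomyHydroLimitInBandActivityTailsOfTransfer
import Summits.AtomisticToContinuum.HydrodynamicLimit.Theorems.TwoClocksTransferEntropyClockFamilyNodesReduction
import Summits.AtomisticToContinuum.HydrodynamicLimit.Theorems.TwoClocksTransferEntropyClockWindowUpgrade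
import Summits.AtomisticToContinuum.HydrodynamicLimit.Theorems.TwoClocksTransferEntropyClockEquilibriumFamily
import Summits.AtomisticToContinuum.HydrodynamicLimit.Theorems.OneFlightGossipEngineClampedTransferDockWindowClauseRate
import Summits.AtomisticToContinuum.HydrodynamicLimit.Theorems.OneFlightGossipEngineClampedTransferDockLedgerEndD
import Summits.AtomisticToContinuum.HydrodynamicLimit.Theorems.ImplosionDichotomyHydroLimitInBandWindowContinuity
import Summits.AtomisticToContinuum.HydrodynamicLimit.Theorems.OneFlightGossipEngineAssembly
import HarnessLib

/-!
# The clock of route TwoClocks over the REFERENCE-LAW coherence typing of crux 17615 (line `Sketch`, crux stmt-AtomisticToContinuum-16625; support file)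

Kernel-checked records for the planner (consolidation of cruxes 16625 / 17615 / 16659). Line `Sketch` of crux 16625 docks the
macroscopic clock `TwoClocks.TransferEntropyClock = KineticWindowLDUniform → ClampedTransferWindowLD → TransferActivityTails →
EnergyCurrentTails → DiluteSelfConsistency → _root_.HydrodynamicLimit` into the shared one-window heart of crux 9133, whose
suprathermal cubic channel is fed by a TRUE-LAW coherence input (`CoherentSuprathermalContentVanishesW`, or the bounded odd window
LLN `BoundedOddWindowLLN` of the sibling file `TwoClocksTransferEntropyClockRestatedOdd.lean`). The sibling crux 17615
`OneFlightGossipEngine.ClampedTransferDock` re-threads that channel through a REFERENCE-LAW input instead — the small-tilt band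
exponential moment `ClampedTransferDockCubicChannelRate.BandCoherenceLDFamily` paid inside the Grönwall by the running entropy,
plus the true-law super-exponential energy tails `SuperExponentialEnergyTails` (SEET) — and its conditional closing is LANDED
(`ClampedTransferDockSketch.clampedTransferDock_of_inputs`, p140743; its six-line plumbing proof over the landed rate window clause
p139114, per-window estimate p136014, rate cubic channel p138311, D-shape ledger end p139514, window continuity and a-priori bound is
repeated inside `hydrodynamicLimit_of_familyNodes_of_band` below rather than imported, only because the farm had not yet built that
module when this record was written). This file records that the 16625 clock closes through THAT closing as well, so that both cruxes
can be split into ONE common set of children: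

* `hydrodynamicLimit_of_familyNodes_of_band` — the restated clock, variant B: the sub-problem Statement from the kinetic family
  node, the local clamped-transfer family node, SEET, the band exponential moment and the two true-law tail antecedents of the crux;
* `transferEntropyClock_of_nodesB` — the crux by name from those four nodes (KWLDU, C′, DSC idle; TA, ECT consumed);
* `transferEntropyClock_of_childrenB` — the crux by name from the two LD stubs of skeleton v9 as typed there (S3b, S4) plus SEET and
  the band exponential moment in place of the true-law coherence stub S5′ (`--glue-by` candidate for a four-child split consuming
  KWLDU through the landed S3x + S3a and C′/TA through S4);
* the SEET-discharged form (no `EnergyCurrentTails`) and the same statements over the ROUTE ITEMS of route OneFlightGossipEngine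
  rev 32 (stmt-16659 / 17691 / 17701 / 17700, byte-identical with the registered stub signatures) are in the sibling file
  `TwoClocksTransferEntropyClockRestatedBandItems.lean`.
Lead prover-line-stmt-AtomisticToContinuum-16625-c5-0, cycle 2.
-/

namespace Summit.AtomisticToContinuum.HydrodynamicLimit.Theorems.TransferEntropyClockRestatedBand

open Summit.AtomisticToContinuum.HydrodynamicLimit.Theses
open Summit.AtomisticToContinuum.HydrodynamicLimit.Theorems
open Summit.AtomisticToContinuum.HydrodynamicLimit.Theorems.HydroLimitInBandOfHeart
  (GronwallCoreInBand LocalClampedTransferWindowLDFamily KineticCurrentsWindowLDFamily)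
open Summit.AtomisticToContinuum.HydrodynamicLimit.Theorems.ClampedCurrentsDockFromWindows (WindowContinuityInBand)
open Summit.AtomisticToContinuum.HydrodynamicLimit.Theorems.TransferEntropyClockFrame
  (EquilibriumKineticLDFamily stub_equilibriumFamily)
open Summit.AtomisticToContinuum.HydrodynamicLimit.Theorems.ClampedTransferDockCubicRate
  (SuperExponentialEnergyTails BandCoherenceLDFamily stub_cubicChannelRate)
open Summit.AtomisticToContinuum.HydrodynamicLimit.Theorems.ClampedTransferDockRate (stub_windowEstimateRate stub_windowClauseRate)
open Summit.AtomisticToContinuum.HydrodynamicLimit.Theorems.ClampedTransferDockLedgerEndD (stub_ledgerEndD)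
open Summit.AtomisticToContinuum.HydrodynamicLimit.Theorems.TransferEntropyClockFamilyNodes
  (transferActivityTails_iff_dock)

/-- **The restated clock, variant B (reference-law coherence)**: the sub-problem Statement from the kinetic family node, the
local clamped-transfer family node, the super-exponential energy tails, the band exponential moment and the crux's two true-law
tail antecedents — the plumbing of crux 17615's landed conditional closing `ClampedTransferDockSketch.clampedTransferDock_of_inputs`
(rate window clause fed the per-window estimate and the rate cubic channel; window continuity from CAT, CEAT, ECT; D-shape ledger end
with the a-priori bound; `relEntropyVanishingInBand_of_gronwallCoreInBand`; `hydroLimitInBand_of_relEntropyVanishingInBand`), with CAT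
and CEAT read off the transfer-activity tails (`HydroLimitInBandHeart.activityTails_of_transferActivityTails`), ECT the board item
(`twoClocks_energyCurrentTails_iff`) and `_root_.HydrodynamicLimit = ImplosionDichotomy.HydroLimitInBand` (same term).
[cite: Yau1991, §2] -/
theorem hydrodynamicLimit_of_familyNodes_of_band :
    KineticCurrentsWindowLDFamily → LocalClampedTransferWindowLDFamily → SuperExponentialEnergyTails →
      BandCoherenceLDFamily → TwoClocks.TransferActivityTails → TwoClocks.EnergyCurrentTails → _root_.HydrodynamicLimit := by
  intro hK hL hS hB h₇ h₆
  have hT := HydroLimitInBandHeart.activityTails_of_transferActivityTails (transferActivityTails_iff_dock.mp h₇)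
  have h₆' : OneFlightGossipEngine.EnergyCurrentTails := twoClocks_energyCurrentTails_iff.mp h₆
  have hOW := stub_windowClauseRate stub_windowEstimateRate stub_cubicChannelRate hB hS hL hT.2 hK hT.1 h₆'
  have hC : WindowContinuityInBand := HydroLimitInBandContinuity.stub_windowContinuityInBand hT.1 hT.2 h₆'
  have hG : GronwallCoreInBand := stub_ledgerEndD hOW hC EntropyClockDock.ledgerAprioriBound
  exact Theorems.hydroLimitInBand_of_relEntropyVanishingInBand
    (EntropyClockDock.relEntropyVanishingInBand_of_gronwallCoreInBand hG)

/-- **The crux by name from the four variant-B nodes**: `KineticWindowLDUniform`, `ClampedTransferWindowLD` and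
`DiluteSelfConsistency` are idle, `TransferActivityTails` and `EnergyCurrentTails` are consumed. [cite: Yau1991, §2] -/
theorem transferEntropyClock_of_nodesB :
    KineticCurrentsWindowLDFamily → LocalClampedTransferWindowLDFamily → SuperExponentialEnergyTails →
      BandCoherenceLDFamily → TwoClocks.TransferEntropyClock :=
  fun hK hL hS hB _ _ h₇ h₆ _ => hydrodynamicLimit_of_familyNodes_of_band hK hL hS hB h₇ h₆

/-- **Split glue, variant B**: the crux by name from the two LD stubs of skeleton v9 AS TYPED there — S3b
`EquilibriumKineticLDFamily → KineticCurrentsWindowLDFamily`, S4 `ClampedTransferWindowLD → TransferActivityTails →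
LocalClampedTransferWindowLDFamily` — plus SEET and the band exponential moment (the reference-law coherence children of crux
17615). KWLDU is consumed through the landed S3x window upgrade (`TransferEntropyClockWindows.stub_windowUpgrade`) and S3a
equilibrium-family theorem (`TransferEntropyClockFrame.stub_equilibriumFamily`), C′ and TA through S4. [cite: Yau1991, §2] -/
theorem transferEntropyClock_of_childrenB :
    (EquilibriumKineticLDFamily → KineticCurrentsWindowLDFamily) →
      (TwoClocks.ClampedTransferWindowLD → TwoClocks.TransferActivityTails → LocalClampedTransferWindowLDFamily) →
        SuperExponentialEnergyTails → BandCoherenceLDFamily → TwoClocks.TransferEntropyClock :=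
  fun hS3b hS4 hS hB hKW h₃ h₇ h₆ hD =>
    transferEntropyClock_of_nodesB
      (hS3b (stub_equilibriumFamily
        (show TransferEntropyClockFrame.WindowUpgrade from TransferEntropyClockWindows.stub_windowUpgrade) hKW))
      (hS4 h₃ h₇) hS hB hKW h₃ h₇ h₆ hD

end Summit.AtomisticToContinuum.HydrodynamicLimit.Theorems.TransferEntropyClockRestatedBand
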